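import Summits.AtomisticToContinuum.Crystallization.Theorems.ExcessDecayLiouvilleKLipschitz
import Summits.AtomisticToContinuum.Crystallization.Theorems.ExcessDecayLiouvilleDirichletSolve
import Summits.AtomisticToContinuum.Crystallization.Theorems.ExcessDecayLiouvilleEnergyIdentity

/-!
# Route `ExcessDecayLiouville`: the per-bond linearisation remainder (nonlinear half, I)

Harmonic-replacement architecture for item `ExcessDecay` (stmt-AtomisticToContinuum-9334), nonlinear half.
With the Lennard-Jones pair force written as `F(x) = h(|x|²) x` (`ljForce_eq_smul`) and the force-constant map
`K(e)`, the per-bond remainder `R(e, w) = F(e + w) − F(e) − K(e) w` satisfies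

* `remainder_antisymm` : `R(−e, −w) = −R(e, w)` (Newton's third law at second order);
* `remainder_split` : `R(e, a + d) − R(e, a) = R(e + a, d) + (K(e + a) d − K(e) d)` (pure algebra);
* `norm_remainder_le` : `‖R(e, w)‖ ≤ 6000 |e|⁻⁹ ‖w‖²` (`|e| ≥ 9/10`, `‖w‖ ≤ 1/10`, a repackaging of
  `norm_ljForce_linearisation_le`);
* `norm_remainder_split_le` : `‖R(e, a + d) − R(e, a)‖ ≤ 6000 |e + a|⁻⁹ ‖d‖² + 200000 |e|⁻⁹ ‖a‖ ‖d‖`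
  (`|e| ≥ 23/25`, `‖a‖ ≤ 1/50`, `‖d‖ ≤ 1/10`): the remainder is LIPSCHITZ in the perturbation with a small
  constant, which is what makes the affine-plus-shift self-remainder separable.

All `[folklore]`; helper lemmas, nothing here closes an item.
-/

noncomputable section

namespace Summit.AtomisticToContinuum.Crystallization.Theorems.ExcessDecayLiouville

open scoped BigOperators Topology InnerProductSpace RealInnerProductSpace Classical
open Literature.MathematicalPhysics.StatisticalMechanics
open Summit.AtomisticToContinuum.Crystallization.Theorems.PhononStabilityNegative

-- Local notation: the force-constant map `K(e)w = h(|e|²)w + 2⟪e,w⟫h′(|e|²)e`.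
local notation3 "𝕂[" e "] " w:max =>
  (-((‖e‖ ^ 2)⁻¹) ^ 7 + ((‖e‖ ^ 2)⁻¹) ^ 4) • w + (2 * ⟪e, w⟫ * (7 * ((‖e‖ ^ 2)⁻¹) ^ 8 - 4 * ((‖e‖ ^ 2)⁻¹) ^ 5)) • e
-- Local notation: the pair force `F(x) = h(|x|²) x`.
local notation3 "𝐅[" x "]" => ((-((‖x‖ ^ 2)⁻¹) ^ 7 + ((‖x‖ ^ 2)⁻¹) ^ 4) • x)
-- Local notation: the remainder `R(e, w) = F(e + w) − F(e) − K(e) w`.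
local notation3 "ℛ[" e ", " w "]" => (𝐅[e + w] - 𝐅[e] - 𝕂[e] w)

/-! ## Algebra -/

/-- The pair force is odd. [folklore] -/
theorem pairForce_neg (x : EuclideanSpace ℝ (Fin 3)) : 𝐅[-x] = -𝐅[x] := by
  rw [norm_neg, smul_neg]

/-- **Antisymmetry of the remainder**: `R(−e, −w) = −R(e, w)`. [folklore] -/
theorem remainder_antisymm (e w : EuclideanSpace ℝ (Fin 3)) : ℛ[-e, -w] = -ℛ[e, w] := by
  have h1 : -e + -w = -(e + w) := by abel
  rw [h1, pairForce_neg, pairForce_neg, forceConst_neg_left, forceConst_neg_right]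
  abel

/-- **Splitting the remainder**: `R(e, a + d) − R(e, a) = R(e + a, d) + (K(e+a) d − K(e) d)`. [folklore] -/
theorem remainder_split (e a d : EuclideanSpace ℝ (Fin 3)) :
    ℛ[e, a + d] - ℛ[e, a] = ℛ[e + a, d] + (𝕂[e + a] d - 𝕂[e] d) := by
  rw [forceConst_add_right e a d, ← add_assoc e a d]
  abel

/-! ## Bounds -/

/-- **The remainder is quadratic**: `‖R(e, w)‖ ≤ 6000 |e|⁻⁹ ‖w‖²` for `|e| ≥ 9/10`, `‖w‖ ≤ 1/10`. [folklore] -/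
theorem norm_remainder_le {e w : EuclideanSpace ℝ (Fin 3)} (he : 9 / 10 ≤ ‖e‖) (hw : ‖w‖ ≤ 1 / 10) :
    ‖ℛ[e, w]‖ ≤ 6000 * (‖e‖⁻¹) ^ 9 * ‖w‖ ^ 2 :=
  norm_ljForce_linearisation_le he hw

/-- **The remainder is Lipschitz in the perturbation with a small constant**: for `|e| ≥ 23/25`,
`‖a‖ ≤ 1/50`, `‖d‖ ≤ 1/10`,
`‖R(e, a + d) − R(e, a)‖ ≤ 6000 |e + a|⁻⁹ ‖d‖² + 200000 |e|⁻⁹ ‖a‖ ‖d‖`. [folklore] -/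
theorem norm_remainder_split_le {e a d : EuclideanSpace ℝ (Fin 3)} (he : 23 / 25 ≤ ‖e‖) (ha : ‖a‖ ≤ 1 / 50)
    (hd : ‖d‖ ≤ 1 / 10) :
    ‖ℛ[e, a + d] - ℛ[e, a]‖ ≤ 6000 * (‖e + a‖⁻¹) ^ 9 * ‖d‖ ^ 2 + 200000 * (‖e‖⁻¹) ^ 9 * ‖a‖ * ‖d‖ := by
  rw [remainder_split]
  have hea : 9 / 10 ≤ ‖e + a‖ := by
    have h1 : ‖e‖ - ‖a‖ ≤ ‖e + a‖ := by
      have := norm_sub_norm_le e (-a)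
      rw [sub_neg_eq_add, norm_neg] at this
      linarith [abs_sub_abs_le_abs_sub ‖e‖ ‖a‖, norm_sub_le e (e + a)]
    linarith
  have he9 : 9 / 10 ≤ ‖e‖ := by linarith
  have ha' : ‖a‖ ≤ ‖e‖ / 4 := by linarith
  have h1 := norm_remainder_le hea hd
  have h2 := norm_forceConst_shift_sub_le he9 ha' d
  calc ‖ℛ[e + a, d] + (𝕂[e + a] d - 𝕂[e] d)‖ ≤ ‖ℛ[e + a, d]‖ + ‖𝕂[e + a] d - 𝕂[e] d‖ := norm_add_le _ _
    _ ≤ 6000 * (‖e + a‖⁻¹) ^ 9 * ‖d‖ ^ 2 + 200000 * (‖e‖⁻¹) ^ 9 * ‖a‖ * ‖d‖ := add_le_add h1 h2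

/-- Crude form: for `|e| ≥ 23/25`, `‖a‖ ≤ 1/50`, `‖d‖ ≤ 1/10`, with `|e + a|⁻¹ ≤ (50/49)|e|⁻¹`:
`‖R(e, a + d) − R(e, a)‖ ≤ 210000 |e|⁻⁹ (‖d‖ + ‖a‖) ‖d‖`. [folklore] -/
theorem norm_remainder_split_le' {e a d : EuclideanSpace ℝ (Fin 3)} (he : 23 / 25 ≤ ‖e‖) (ha : ‖a‖ ≤ 1 / 50)
    (hd : ‖d‖ ≤ 1 / 10) :
    ‖ℛ[e, a + d] - ℛ[e, a]‖ ≤ 210000 * (‖e‖⁻¹) ^ 9 * (‖d‖ + ‖a‖) * ‖d‖ := by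
  have h := norm_remainder_split_le he ha hd
  have he0 : 0 < ‖e‖ := by linarith
  have hea : ‖e‖ - 1 / 50 ≤ ‖e + a‖ := by
    have := norm_sub_norm_le e (-a)
    rw [sub_neg_eq_add, norm_neg] at this
    linarith
  have hea0 : 0 < ‖e + a‖ := by linarith
  -- `|e + a|⁻¹ ≤ (50/49)^{?}`: we use `‖e‖ − 1/50 ≥ (45/46)‖e‖` since `‖e‖ ≥ 23/25`
  have hratio : (45 / 46) * ‖e‖ ≤ ‖e + a‖ := by nlinarith
  have hinv : ‖e + a‖⁻¹ ≤ (46 / 45) * ‖e‖⁻¹ := by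
    rw [show (46 / 45 : ℝ) * ‖e‖⁻¹ = ((45 / 46) * ‖e‖)⁻¹ by rw [mul_inv]; norm_num]
    exact (inv_le_inv₀ hea0 (by positivity)).2 hratio
  have hinv9 : (‖e + a‖⁻¹) ^ 9 ≤ (46 / 45 : ℝ) ^ 9 * (‖e‖⁻¹) ^ 9 := by
    calc (‖e + a‖⁻¹) ^ 9 ≤ ((46 / 45) * ‖e‖⁻¹) ^ 9 := pow_le_pow_left₀ (by positivity) hinv 9
      _ = (46 / 45 : ℝ) ^ 9 * (‖e‖⁻¹) ^ 9 := by ring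
  have hc : (46 / 45 : ℝ) ^ 9 ≤ 5 / 4 := by norm_num
  have hd0 : 0 ≤ ‖d‖ := norm_nonneg _
  have ha0 : 0 ≤ ‖a‖ := norm_nonneg _
  have hi0 : 0 ≤ (‖e‖⁻¹) ^ 9 := by positivity
  have h1 : 6000 * (‖e + a‖⁻¹) ^ 9 * ‖d‖ ^ 2 ≤ 7500 * (‖e‖⁻¹) ^ 9 * ‖d‖ ^ 2 := by
    have := mul_le_mul_of_nonneg_right (hinv9.trans (mul_le_mul_of_nonneg_right hc hi0)) (sq_nonneg ‖d‖)
    nlinarith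
  nlinarith [mul_nonneg (mul_nonneg hi0 ha0) hd0, mul_nonneg (mul_nonneg hi0 hd0) hd0]

end Summit.AtomisticToContinuum.Crystallization.Theorems.ExcessDecayLiouville

end
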